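import Literature.Topology.FourManifolds.BordismMerging
import Literature.Topology.FourManifolds.BordismFourNullBordism
import Literature.Topology.FourManifolds.CylinderPuncturedTop
import Literature.Topology.FourManifolds.ConnectedSumCohomology
import Literature.Topology.FourManifolds.SphereSimplyConnected
import Literature.AlgebraicTopology.SingularHomology.MayerVietorisExactness
import Literature.AlgebraicTopology.SingularHomology.ExcisionTheorem
import Literature.AlgebraicTopology.SingularHomology.AcyclicPuncture
import Mathlib.Analysis.Convex.Contractible
import HarnessLib

/-!
# The merging cobordism `W₀ = (M₁ × I) ♮ (M₂ × I)` from `M₁ # M₂` to `M₁ ⊔ M₂`, with its second homology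

Topic `Literature/Topology/FourManifolds`; the last tree-provable input of **Wall's Theorem 2**
(C. T. C. Wall, *On simply-connected 4-manifolds*, J. London Math. Soc. 39 (1964) 141–149,
Thm. 2 and §2 pp. 144–146; the named fact
`Literature.Topology.FourManifolds.isHCobordant_of_equivalent_intersectionForm` of
`HCobordismDonaldson.lean`, assembled from four inputs in `HCobordismWallAssembly.lean`,
`isHCobordant_of_equivalent_intersectionForm_of_constructions hT1 hL2 hreal hmerge`). Wall,
p. 145: "to `N = M₁ # (−M₂)` … we attach `D⁴ × I` along the `S³ × I` of the connected sum, so as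
to fill in the neck; the resulting manifold `R` has boundary components `M₁`, `M₂`", and p. 146:
"the induced maps `H₂(Mᵢ) → H₂(R)`" are computed through "`H₂(N) ≅ H₂(M₁) ⊕ H₂(M₂)`". In the
tree's cobordism vocabulary this neck-filling is the cobordism
`W₀ = (M₁ × I) ♮ (M₂ × I) : M₁ # M₂ ∼ M₁ ⊔ M₂` (Kervaire–Milnor 1963, Lemma 2.2: `∂(W₁ ♮ W₂) = ∂W₁ # ∂W₂`;
Kirby 1989, Ch. VIII: "`M₁ ⊔ M₂` is bordant to `M₁ # M₂` through `(M₁ ⊔ M₂) × I ∪` 1-handle"),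
WITH its second homology — the hypothesis `hmerge` of the assembly. This file CONSTRUCTS `W₀` and
PROVES `hmerge` (`MergingCobordism.hmerge_holds`):

* `MergingCobordism.setup`, `MergingCobordism.cobordism` — the boundary connected sum of the two
  cylinders `Mᵢ × [0, 1]` (`cylinderNullCobordism`) at collar half-discs over discs of the TOP
  copies, verbatim the recipe of `exists_isCobordant_sum_connectedSpace` (`BordismMerging.lean`:
  `NullCobordism.BCSSetup`, Juhász's pushout `HalfDiscPair.exists_isOpenGluing`), its boundary
  `(M₁ ⊔ M₁) # (M₂ ⊔ M₂)` re-presented as `(M₁ ⊔ M₂) ⊔ (M₁ # M₂)` by the uniqueness of open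
  gluings WITH the comparison equations (`IsOpenGluing.exists_diffeomorph_comp_eq`), and `M₁ # M₂`
  identified with the given `N` the same way; hence (`inr_inl_apply`, `inl_jA_apply`) the outgoing
  end of `W₀` is the pair of bottom copies `x ↦ (x, 0)` and the incoming end restricted to the
  punctured piece `M₁ ∖ {i₁ 0} ⊆ N` is the top copy `a ↦ (a, 1)`, ON THE NOSE.
* `MergingCobordism.simplyConnectedSpace_P` — `W₀` is simply connected (van Kampen for the open
  cover by the two punctured cylinders `(Mᵢ × I) ∖ {(iᵢ 0, 1)} ≃ Mᵢ` of `CylinderPuncturedTop.lean`,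
  whose overlap is a punctured closed half-ball, star-convex: `starConvex_puncturedHalfBall`).
* `MergingCobordism.exists_eq_add_map_bottom` — `H₂(W₀)` is generated by the two bottom copies
  (Mayer–Vietoris, Hatcher 2002 §2.2, the overlap being acyclic; `exists_add_eq_of_isZero_inter`).
* `MergingCobordism.exists_cobordism_sum` (any dimension `n + 1 ∉ {2, 3}`) and
  `MergingCobordism.hmerge_holds` (dimension `4`, verbatim the binder of `hmerge`) — with
  `ι₁ = jA_* ∘ (incl_*)⁻¹ : H₂(M₁) ≅ H₂(M₁ ∖ pt) → H₂(N)` (`isIso_map_subsetIncl_compl_singleton`,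
  Hatcher §3.3: `Hₖ(M | x) = 0` for `k ≠ dim M`): `c_{M₁*} ι₁ = id` (`c_{M₁} ∘ jA = incl`),
  `c_{M₂*} ι₁ = 0` (`c_{M₂} ∘ jA` factors through the contractible disc `i₂ (B̄)`),
  `inl_* ι₁ z = (bottom copy)_* z` (the top copy of a class of `M₁ ∖ pt` is homologous in the
  punctured cylinder to its bottom copy, `Cylinder.map_bottomRestrict_eq_map_topRestrict`), and
  `H₂(N) → H₂(W₀)` onto.

Everything is proved; the definitions are explicit constructions (no named facts). With this file
the assembly of Wall's Thm. 2 depends on exactly three inputs: Wall's Thm. 1 (`hT1`), Wall's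
Lemma 2 (`exists_handlebody_isHCobordant_boundary`) and the realisation of the automorphs of the
intersection form of `∂V`, `V ∈ ℋ(5, k, 2)`, by diffeomorphisms (`hreal`, Wall's refs. [10], [11]).

## References

* C. T. C. Wall, *On simply-connected 4-manifolds*, J. London Math. Soc. 39 (1964) 141–149, §2
  pp. 145–146. [WallJLMS1964]
* M. A. Kervaire, J. W. Milnor, *Groups of homotopy spheres: I*, Ann. of Math. (2) 77 (1963), §2,
  Lemma 2.2. [KervaireMilnorAnnals1963]
* R. C. Kirby, *The topology of 4-manifolds*, LNM 1374 (1989), Ch. VIII. [Kirby1989]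
* A. Hatcher, *Algebraic Topology*, CUP (2002), Lemma 1.15, §2.2 pp. 149–150, Prop. 2.8,
  Thm. 2.10, §3.3 p. 231. [HatcherAT2002]
* A. Juhász, *Differential and Low-Dimensional Topology*, CUP (2023), Def. 1.47. [Juhasz2023]
-/

noncomputable section

open scoped Manifold ContDiff Topology
open Set Function TopologicalSpace Topology CategoryTheory CategoryTheory.Limits Metric
open Literature.AlgebraicTopology.SingularHomology

namespace Literature.Topology.FourManifolds

/-- Local notation: `𝔼 n` is the model Euclidean space `EuclideanSpace ℝ (Fin n)`. -/
local notation "𝔼 " n:arg => EuclideanSpace ℝ (Fin n)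

namespace MergingCobordism

/-! ### Mayer–Vietoris: every class of `U ∪ V` is a sum when `Hⱼ(U ∩ V) = 0` -/

section MayerVietoris

universe u

variable {X : Type u} [TopologicalSpace X]

/-- **Mayer–Vietoris, surjectivity half, in elements**: for an open cover `X = U ∪ V` with
`Hⱼ(U ∩ V; ℤ) = 0`, every class of `Hⱼ₊₁(X; ℤ)` is `(i_U)_* u + (i_V)_* v`
(Hatcher 2002, §2.2 p. 149: the connecting map lands in `Hⱼ(U ∩ V) = 0`, exactness at
`Hⱼ₊₁(X)`). [cite: HatcherAT2002, §2.2 p. 149] -/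
theorem exists_add_eq_of_isZero_inter (U V : Set X) (hU : IsOpen U) (hV : IsOpen V)
    (hUV : U ∪ V = univ) {j : ℕ} (h0 : IsZero (singularHomology ℤ ℤ ↥(U ∩ V) j))
    (w : singularHomology ℤ ℤ X (j + 1)) :
    ∃ (u : singularHomology ℤ ℤ U (j + 1)) (v : singularHomology ℤ ℤ V (j + 1)),
      singularHomology.map ℤ ℤ (subsetIncl U) (j + 1) u +
        singularHomology.map ℤ ℤ (subsetIncl V) (j + 1) v = w := by
  have hexc := relativeSingularHomology.isIso_map_of_interior_union_interior_holds ℤ ℤ X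
  have hint : interior U ∪ interior V = univ := by rw [hU.interior_eq, hV.interior_eq, hUV]
  have hδ : mayerVietoris.δ ℤ ℤ U V hexc hint j = 0 := h0.eq_of_tgt _ _
  haveI : Epi (mayerVietoris.ψ ℤ ℤ U V (j + 1)) :=
    (mayerVietoris.exact₂_holds ℤ ℤ U V hexc hint j).epi_f hδ
  obtain ⟨y, hy⟩ := (ModuleCat.epi_iff_surjective (mayerVietoris.ψ ℤ ℤ U V (j + 1))).1
    inferInstance w
  refine ⟨(biprod.fst : singularHomology ℤ ℤ U (j + 1) ⊞ singularHomology ℤ ℤ V (j + 1) ⟶ _) y,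
    (biprod.snd : singularHomology ℤ ℤ U (j + 1) ⊞ singularHomology ℤ ℤ V (j + 1) ⟶ _) y, ?_⟩
  rw [← hy, mayerVietoris.ψ, biprod_desc_apply]

end MayerVietoris

/-! ### Puncturing a manifold does not change `H₂` in dimension `≥ 4` -/

section Puncture

/-- **`Hₖ(M ∖ x; ℤ) ≅ Hₖ(M; ℤ)` for `k, k + 1 ≠ dim M`** (exact sequence of the pair `(M, M ∖ x)`
with `Hₖ(M | x) = Hₖ₊₁(M | x) = 0`, Hatcher 2002, §3.3 p. 231 and Thm. 2.16).
[cite: HatcherAT2002, §3.3 p. 231 and Thm. 2.16] -/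
theorem isIso_map_subsetIncl_compl_singleton {M : Type} [TopologicalSpace M] [T2Space M] {m : ℕ}
    [ChartedSpace (𝔼 m) M] (x : M) {k : ℕ} (hk : k ≠ m) (hk1 : k + 1 ≠ m) :
    IsIso (singularHomology.map ℤ ℤ (subsetIncl ({x}ᶜ : Set M)) k) := by
  have hz : ∀ {i : ℕ}, i ≠ m → IsZero (relativeSingularHomology ℤ ℤ M ({x}ᶜ : Set M) i) :=
    fun hi => isZero_localHomology_holds (R := ℤ) (M := ℤ) M (n := m) x hi
  have hmono : Mono (singularHomology.map ℤ ℤ (subsetIncl ({x}ᶜ : Set M)) k) :=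
    (relativeSingularHomology.exact_δ_map ℤ ℤ ({x}ᶜ : Set M) k).mono_g ((hz hk1).eq_of_src _ _)
  have hepi : Epi (singularHomology.map ℤ ℤ (subsetIncl ({x}ᶜ : Set M)) k) :=
    (relativeSingularHomology.exact_map_ofAbsolute ℤ ℤ ({x}ᶜ : Set M) k).epi_f
      ((hz hk).eq_of_tgt _ _)
  exact isIso_of_mono_of_epi _

end Puncture

/-! ### The punctured closed half-ball is star-convex -/

section HalfBall

variable (m : ℕ)

/-- The punctured closed unit half-ball `{0 ≤ w₀, 0 < ‖w‖ < 1}` of `ℝᵐ⁺¹` (parametrising the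
overlap of the two pieces of a boundary connected sum, face included). [cite: Juhasz2023, Def. 1.47] -/
def puncturedHalfBall : Set (𝔼 (m + 1)) := {w | 0 ≤ w 0 ∧ 0 < ‖w‖ ∧ ‖w‖ < 1}

/-- The centre `e₀ / 2` of the star. [folklore] -/
def halfPole : 𝔼 (m + 1) := EuclideanSpace.single 0 2⁻¹

/-- The `0`-th coordinate of the centre is `1/2`. [folklore] -/
theorem halfPole_apply_zero : halfPole m 0 = 2⁻¹ := by
  rw [halfPole, show EuclideanSpace.single (0 : Fin (m + 1)) (2⁻¹ : ℝ) = PiLp.single 2 0 2⁻¹ from rfl,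
    PiLp.single_apply, if_pos rfl]

/-- The centre has norm `1/2`. [folklore] -/
theorem norm_halfPole : ‖halfPole m‖ = 2⁻¹ := by
  rw [halfPole, show EuclideanSpace.single (0 : Fin (m + 1)) (2⁻¹ : ℝ) = PiLp.single 2 0 2⁻¹ from rfl,
    PiLp.norm_single, Real.norm_eq_abs, abs_of_pos (by norm_num)]

/-- The centre lies in the punctured closed half-ball. [folklore] -/
theorem halfPole_mem : halfPole m ∈ puncturedHalfBall m := by
  refine ⟨?_, ?_, ?_⟩
  · rw [halfPole_apply_zero]; norm_num
  · rw [norm_halfPole]; norm_num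
  · rw [norm_halfPole]; norm_num

/-- **The punctured closed half-ball is star-convex about `e₀ / 2`.** [folklore] -/
theorem starConvex_puncturedHalfBall : StarConvex ℝ (halfPole m) (puncturedHalfBall m) := by
  intro w hw a b ha hb hab
  obtain ⟨hw0, hwpos, hw1⟩ := hw
  rcases ha.eq_or_lt with rfl | ha'
  · rw [zero_add] at hab
    subst hab
    rw [zero_smul, zero_add, one_smul]
    exact ⟨hw0, hwpos, hw1⟩
  have hcoord : 0 < (a • halfPole m + b • w) 0 := by
    have : 0 ≤ b * w 0 := mul_nonneg hb hw0
    simp only [PiLp.add_apply, PiLp.smul_apply, smul_eq_mul, halfPole_apply_zero]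
    nlinarith
  refine ⟨hcoord.le, ?_, ?_⟩
  · refine norm_pos_iff.2 fun h => ?_
    rw [h] at hcoord
    exact lt_irrefl _ hcoord
  · calc ‖a • halfPole m + b • w‖ ≤ ‖a • halfPole m‖ + ‖b • w‖ := norm_add_le _ _
      _ = a * 2⁻¹ + b * ‖w‖ := by
        rw [norm_smul, norm_smul, norm_halfPole, Real.norm_eq_abs, Real.norm_eq_abs,
          abs_of_nonneg ha, abs_of_nonneg hb]
      _ < a + b := by
        have : b * ‖w‖ ≤ b := by nlinarith
        nlinarith
      _ = 1 := hab

/-- The punctured closed half-ball is contractible. [folklore] -/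
instance contractibleSpace_puncturedHalfBall : ContractibleSpace ↥(puncturedHalfBall m) :=
  (starConvex_puncturedHalfBall m).contractibleSpace ⟨_, halfPole_mem m⟩

/-- A point of the punctured closed half-ball as a point of the closed half-space. [folklore] -/
def toHalfSpace' (w : ↥(puncturedHalfBall m)) : EuclideanHalfSpace (m + 1) := ⟨w.1, w.2.1⟩

/-- The punctured closed half-ball embeds in the closed half-space. [folklore] -/
theorem isEmbedding_toHalfSpace' : IsEmbedding (toHalfSpace' m) :=
  (IsEmbedding.subtypeVal (p := fun w => w ∈ puncturedHalfBall m)).codRestrict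
    {x : 𝔼 (m + 1) | 0 ≤ x 0} fun w => w.2.1

/-- Points of the punctured closed half-ball have positive norm. [folklore] -/
theorem norm_toHalfSpace'_pos (w : ↥(puncturedHalfBall m)) : 0 < ‖(toHalfSpace' m w).val‖ := w.2.2.1

/-- Points of the punctured closed half-ball have norm `< 1`. [folklore] -/
theorem norm_toHalfSpace'_lt (w : ↥(puncturedHalfBall m)) : ‖(toHalfSpace' m w).val‖ < 1 := w.2.2.2

end HalfBall

/-! ### One side of the merging cobordism, seen from its cylinder -/

section Side

variable {M : Type} [TopologicalSpace M] {P : Type} [TopologicalSpace P]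

/-- **One piece of the boundary connected sum of two cylinders, abstractly**: an open embedding
`ι` of the punctured cylinder `(M × [0, 1]) ∖ {(x₀, 1)}` into `P`. [folklore] -/
structure CylinderSide (M : Type) [TopologicalSpace M] (P : Type) [TopologicalSpace P] where
  /-- the removed point of the top copy -/
  x₀ : M
  /-- the embedding of the punctured cylinder -/
  ι : ↥(Cylinder.complTop x₀) → P
  isEmbedding_ι : IsEmbedding ι
  isOpen_range_ι : IsOpen (range ι)

namespace CylinderSide

variable (S : CylinderSide M P)

/-- `ι` as a continuous map. [folklore] -/
def ιC : C(↥(Cylinder.complTop S.x₀), P) := ⟨S.ι, S.isEmbedding_ι.continuous⟩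

/-- The punctured cylinder is homeomorphic to its image `range ι`. [folklore] -/
def homeo : ↥(Cylinder.complTop S.x₀) ≃ₜ ↥(range S.ι) := S.isEmbedding_ι.toHomeomorph

/-- The homeomorphism onto the image is `ι` on points. [folklore] -/
@[simp] theorem coe_homeo (p : ↥(Cylinder.complTop S.x₀)) : (S.homeo p : P) = S.ι p := rfl

/-- The bottom copy `x ↦ ι (x, 0)` of `M` in `P`. [folklore] -/
def bottom : C(M, P) := S.ιC.comp (Cylinder.bottomToComplTop S.x₀)

/-- The top copy `x ↦ ι (x, 1)` of `M ∖ {x₀}` in `P`. [folklore] -/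
def top : C(↥({S.x₀}ᶜ : Set M), P) := S.ιC.comp (Cylinder.topRestrict S.x₀)

/-- Values of the bottom copy. [folklore] -/
@[simp] theorem bottom_apply (x : M) : S.bottom x = S.ι (Cylinder.bottomToComplTop S.x₀ x) := rfl

/-- Values of the top copy. [folklore] -/
@[simp] theorem top_apply (x : ↥({S.x₀}ᶜ : Set M)) : S.top x = S.ι (Cylinder.topRestrict S.x₀ x) := rfl

/-- `range ι` is simply connected when `M` is. [cite: HatcherAT2002, Prop. 1.18] -/
theorem isSimplyConnected_range [SimplyConnectedSpace M] : IsSimplyConnected (range S.ι) := by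
  haveI := Cylinder.simplyConnectedSpace_complTop S.x₀
  show SimplyConnectedSpace ↥(range S.ι)
  exact S.homeo.toHomotopyEquiv.simplyConnectedSpace_iff.1 inferInstance

/-- **The top copy and the bottom copy of a class of `M ∖ {x₀}` agree in `Hₖ(P)`**:
`top_* = bottom_* ∘ (incl)_*`. [cite: HatcherAT2002, Thm. 2.10] -/
theorem map_top (k : ℕ) : singularHomology.map ℤ ℤ S.top k =
    singularHomology.map ℤ ℤ (subsetIncl ({S.x₀}ᶜ : Set M)) k ≫ singularHomology.map ℤ ℤ S.bottom k := by
  rw [top, singularHomology.map_comp, ← Cylinder.map_bottomRestrict_eq_map_topRestrict,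
    Cylinder.bottomRestrict_eq_comp, singularHomology.map_comp, Category.assoc, bottom,
    singularHomology.map_comp]

/-- **Every class of `Hₖ(range ι)` comes from the bottom copy of `M`.** [cite: HatcherAT2002, Cor. 2.11] -/
theorem exists_map_subsetIncl_eq_map_bottom (k : ℕ) (u : singularHomology ℤ ℤ ↥(range S.ι) k) :
    ∃ z : singularHomology ℤ ℤ M k,
      singularHomology.map ℤ ℤ (subsetIncl (range S.ι)) k u = singularHomology.map ℤ ℤ S.bottom k z := by
  haveI := Cylinder.isIso_map_bottomToComplTop ℤ S.x₀ k
  let e := singularHomology.mapIso ℤ ℤ S.homeo k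
  obtain ⟨p, rfl⟩ : ∃ p, e.hom p = u :=
    ⟨e.inv u, by rw [← ModuleCat.comp_apply, e.inv_hom_id]; rfl⟩
  obtain ⟨z, rfl⟩ := (ModuleCat.epi_iff_surjective
    (singularHomology.map ℤ ℤ (Cylinder.bottomToComplTop S.x₀) k)).1 inferInstance p
  refine ⟨z, ?_⟩
  have hfac : S.bottom = (subsetIncl (range S.ι)).comp
      ((⟨S.homeo, S.homeo.continuous⟩ : C(_, _)).comp (Cylinder.bottomToComplTop S.x₀)) := by
    ext x; rfl
  rw [hfac, singularHomology.map_comp, singularHomology.map_comp, ModuleCat.comp_apply,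
    ModuleCat.comp_apply]
  rfl

end CylinderSide

end Side



/-! ### The boundary connected sum of the two cylinders -/

section Setup

variable {n : ℕ} {M₁ M₂ : Type} [TopologicalSpace M₁] [T2Space M₁] [SecondCountableTopology M₁]
  [ChartedSpace (𝔼 (n + 1)) M₁] [IsManifold (𝓡 (n + 1)) ∞ M₁] [CompactSpace M₁]
  [TopologicalSpace M₂] [T2Space M₂] [SecondCountableTopology M₂]
  [ChartedSpace (𝔼 (n + 1)) M₂] [IsManifold (𝓡 (n + 1)) ∞ M₂] [CompactSpace M₂]
  (D : ConnectedSumData (n + 1) M₁ M₂)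

/-- The cylinder `M₁ × [0, 1]` as a null-cobordism of `M₁ ⊔ M₁` (first piece). [folklore] -/
abbrev cS (M₁ : Type) [TopologicalSpace M₁] [T2Space M₁] [SecondCountableTopology M₁]
    [ChartedSpace (𝔼 (n + 1)) M₁] [IsManifold (𝓡 (n + 1)) ∞ M₁] [CompactSpace M₁] :
    NullCobordism (n + 1) (M₁ ⊕ M₁) :=
  cylinderNullCobordism (n + 1) M₁

/-- The connected sum data lifted to the top copies of the doubles. [folklore] -/
abbrev Dσ : ConnectedSumData (n + 1) (M₁ ⊕ M₁) (M₂ ⊕ M₂) := D.sumInr (A' := M₁) (B' := M₂)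

variable (κS : (cS (n := n) M₁).boundaryData.Collar) (κT : (cS (n := n) M₂).boundaryData.Collar)
  {P : Type} [TopologicalSpace P] [ChartedSpace (EuclideanHalfSpace (n + 2)) P]
  (W : HalfGluing (κS.halfDisc (Dσ D).i₁) (κT.halfDisc (Dσ D).i₂) P)

/-! #### The punctures are the top points `(i₁ 0, 1)`, `(i₂ 0, 1)` -/

omit [T2Space M₂] [SecondCountableTopology M₂] [CompactSpace M₂] in
/-- The centre of the first half-disc is the top point `(i₁ 0, 1)` of the first cylinder.
[cite: Hirsch1976, §4.6] -/
theorem halfDisc_zero_S : κS.halfDisc (Dσ D).i₁ 0 = Cylinder.topPt (D.i₁ 0) := by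
  rw [← EuclideanHalfSpace.face_zero, BoundaryData.Collar.halfDisc_face]
  rfl

omit [T2Space M₁] [SecondCountableTopology M₁] [CompactSpace M₁] in
/-- The centre of the second half-disc is the top point `(i₂ 0, 1)` of the second cylinder.
[cite: Hirsch1976, §4.6] -/
theorem halfDisc_zero_T : κT.halfDisc (Dσ D).i₂ 0 = Cylinder.topPt (D.i₂ 0) := by
  rw [← EuclideanHalfSpace.face_zero, BoundaryData.Collar.halfDisc_face]
  rfl

omit [T2Space M₂] [SecondCountableTopology M₂] [CompactSpace M₂] in
/-- The first punctured piece is the first cylinder with the top point `(i₁ 0, 1)` removed.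
[folklore] -/
theorem coe_puncture_S :
    ((puncture (κS.halfDisc (Dσ D).i₁) : Opens (cS (n := n) M₁).W) : Set (cS (n := n) M₁).W) =
      Cylinder.complTop (D.i₁ 0) := by
  rw [coe_puncture, halfDisc_zero_S]
  rfl

omit [T2Space M₁] [SecondCountableTopology M₁] [CompactSpace M₁] in
/-- The second punctured piece is the second cylinder with the top point `(i₂ 0, 1)` removed.
[folklore] -/
theorem coe_puncture_T :
    ((puncture (κT.halfDisc (Dσ D).i₂) : Opens (cS (n := n) M₂).W) : Set (cS (n := n) M₂).W) =
      Cylinder.complTop (D.i₂ 0) := by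
  rw [coe_puncture, halfDisc_zero_T]
  rfl

/-- The identification of the punctured first cylinder with the first punctured piece. [folklore] -/
def castS : ↥(Cylinder.complTop (D.i₁ 0)) ≃ₜ ↥(puncture (κS.halfDisc (Dσ D).i₁)) :=
  Homeomorph.setCongr (coe_puncture_S D κS).symm

/-- The identification of the punctured second cylinder with the second punctured piece. [folklore] -/
def castT : ↥(Cylinder.complTop (D.i₂ 0)) ≃ₜ ↥(puncture (κT.halfDisc (Dσ D).i₂)) :=
  Homeomorph.setCongr (coe_puncture_T D κT).symm

/-- The first side of the boundary connected sum, seen from its cylinder. [folklore] -/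
def sideS : CylinderSide M₁ P where
  x₀ := D.i₁ 0
  ι := W.ι₁ ∘ castS D κS
  isEmbedding_ι := W.h₁.isEmbedding.comp (castS D κS).isEmbedding
  isOpen_range_ι := by rw [(castS D κS).surjective.range_comp]; exact W.h₁o

/-- The second side of the boundary connected sum, seen from its cylinder. [folklore] -/
def sideT : CylinderSide M₂ P where
  x₀ := D.i₂ 0
  ι := W.ι₂ ∘ castT D κT
  isEmbedding_ι := W.h₂.isEmbedding.comp (castT D κT).isEmbedding
  isOpen_range_ι := by rw [(castT D κT).surjective.range_comp]; exact W.h₂o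

/-- The image of the first side is the first piece `range ι₁`. [folklore] -/
theorem range_sideS_ι : range (sideS D κS κT W).ι = range W.ι₁ := (castS D κS).surjective.range_comp _

/-- The image of the second side is the second piece `range ι₂`. [folklore] -/
theorem range_sideT_ι : range (sideT D κS κT W).ι = range W.ι₂ := (castT D κT).surjective.range_comp _

/-- Values of the embedding of the first side. [folklore] -/
theorem sideS_ι_apply (p : ↥(Cylinder.complTop (D.i₁ 0))) (h) :
    (sideS D κS κT W).ι p = W.ι₁ ⟨p.1, h⟩ := rfl

/-- Values of the embedding of the second side. [folklore] -/
theorem sideT_ι_apply (p : ↥(Cylinder.complTop (D.i₂ 0))) (h) :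
    (sideT D κS κT W).ι p = W.ι₂ ⟨p.1, h⟩ := rfl


section Glued

variable [Nonempty M₁] [Nonempty M₂] [T2Space P] [SecondCountableTopology P]
  [IsManifold (𝓡∂ (n + 2)) ∞ P] [CompactSpace P]

/-- **The boundary-connected-sum setup of the two cylinders** at discs of the top copies (the
recipe of `exists_isCobordant_sum_connectedSpace`, `BordismMerging.lean`, with the collars and the
half-gluing as parameters). [cite: KervaireMilnorAnnals1963, §2 Lemma 2.2] -/
def setup : NullCobordism.BCSSetup n where
  MS := M₁ ⊕ M₁
  MT := M₂ ⊕ M₂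
  MU := ((Dσ D).glueData (Nat.succ_ne_zero n)).Glued
  cS := cS M₁
  cT := cS M₂
  κS := κS
  κT := κT
  iS := (Dσ D).i₁
  iT := (Dσ D).i₂
  hiS := (Dσ D).isSmoothEmbedding_i₁
  hiT := (Dσ D).isSmoothEmbedding_i₂
  P := P
  W := W
  Dσ := Dσ D
  hD₁ := rfl
  hD₂ := rfl
  jA := ((Dσ D).glueData (Nat.succ_ne_zero n)).inl
  jB := ((Dσ D).glueData (Nat.succ_ne_zero n)).inr
  hjA := ((Dσ D).glueData (Nat.succ_ne_zero n)).isSmoothEmbedding_inl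
  hjAo := ((Dσ D).glueData (Nat.succ_ne_zero n)).isOpen_range_inl
  hjB := ((Dσ D).glueData (Nat.succ_ne_zero n)).isSmoothEmbedding_inr
  hjBo := ((Dσ D).glueData (Nat.succ_ne_zero n)).isOpen_range_inr
  Ψ := Diffeomorph.refl _ _ _
  hΨA := fun _ => rfl
  hΨB := fun _ => rfl

/-! #### The overlap of the two pieces is a punctured closed half-ball -/

/-- The parametrisation of the overlap by the punctured closed half-ball: `w ↦ ι₁ (k_S w)`.
[cite: Juhasz2023, Def. 1.47] -/
def θ' (w : ↥(puncturedHalfBall (n + 1))) : P :=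
  W.ι₁ ⟨κS.halfDisc (Dσ D).i₁ (toHalfSpace' (n + 1) w),
    (setup D κS κT W).kS_mem_puncture (norm_toHalfSpace'_pos (n + 1) w)⟩

/-- The parametrisation of the overlap is a topological embedding. [cite: Juhasz2023, Def. 1.47] -/
theorem isEmbedding_θ' : IsEmbedding (θ' D κS κT W) := by
  have h1 : IsEmbedding fun w : ↥(puncturedHalfBall (n + 1)) =>
      (⟨κS.halfDisc (Dσ D).i₁ (toHalfSpace' (n + 1) w),
        (setup D κS κT W).kS_mem_puncture (norm_toHalfSpace'_pos (n + 1) w)⟩ :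
          ↥(puncture (κS.halfDisc (Dσ D).i₁))) :=
    ((setup D κS κT W).isSmoothEmbedding_kS.1.isEmbedding.comp (isEmbedding_toHalfSpace' _)).codRestrict _ _
  exact W.h₁.isEmbedding.comp h1

/-- **The overlap of the two pieces is exactly the image of the punctured closed half-ball**
(`ι₁_kS_mem_range_ι₂`, `exists_eq_kS_of_mem_range`). [cite: Juhasz2023, Def. 1.47] -/
theorem range_θ' : range (θ' D κS κT W) = range W.ι₁ ∩ range W.ι₂ := by
  apply Subset.antisymm
  · rintro _ ⟨w, rfl⟩
    exact ⟨⟨_, rfl⟩, (setup D κS κT W).ι₁_kS_mem_range_ι₂ (norm_toHalfSpace'_pos (n + 1) w)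
      (norm_toHalfSpace'_lt (n + 1) w)⟩
  · rintro _ ⟨⟨a, rfl⟩, ha⟩
    obtain ⟨v, hv0, hv1, hav⟩ := (setup D κS κT W).exists_eq_kS_of_mem_range a ha
    refine ⟨⟨v.val, v.2, hv0, hv1⟩, ?_⟩
    change W.ι₁ _ = W.ι₁ a
    congr 1
    exact Subtype.ext hav.symm

/-- The overlap of the two pieces is homeomorphic to the punctured closed half-ball. [cite: Juhasz2023, Def. 1.47] -/
def overlapHomeo' : ↥(puncturedHalfBall (n + 1)) ≃ₜ ↥(range W.ι₁ ∩ range W.ι₂) :=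
  (isEmbedding_θ' D κS κT W).toHomeomorph.trans (Homeomorph.setCongr (range_θ' D κS κT W))

/-- The overlap of the two pieces is path connected. [folklore] -/
theorem isPathConnected_inter : IsPathConnected (range W.ι₁ ∩ range W.ι₂) := by
  rw [← range_θ' D κS κT W]
  exact isPathConnected_range (isEmbedding_θ' D κS κT W).continuous

/-- The overlap of the two pieces has no homology in positive degrees. [cite: HatcherAT2002, Prop. 2.8] -/
theorem isZero_singularHomology_inter {j : ℕ} (hj : j ≠ 0) :
    IsZero (singularHomology ℤ ℤ ↥(range W.ι₁ ∩ range W.ι₂) j) :=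
  (isZero_singularHomology_of_contractibleSpace ℤ ℤ (X := ↥(puncturedHalfBall (n + 1))) hj).of_iso
    (singularHomology.mapIso ℤ ℤ (overlapHomeo' D κS κT W) j).symm

include W in
/-- **`W_U = W_S ♮ W_T` is simply connected** when `M₁`, `M₂` are (van Kampen for the open cover
by the two punctured cylinders, which are simply connected, with path-connected overlap).
[cite: HatcherAT2002, Lemma 1.15] -/
theorem simplyConnectedSpace_P [SimplyConnectedSpace M₁] [SimplyConnectedSpace M₂] :
    SimplyConnectedSpace P :=
  simplyConnectedSpace_of_isOpen_union W.h₁o W.h₂o W.cover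
    (by rw [← range_sideS_ι D κS κT W]; exact (sideS D κS κT W).isSimplyConnected_range)
    (by rw [← range_sideT_ι D κS κT W]; exact (sideT D κS κT W).isSimplyConnected_range)
    (isPathConnected_inter D κS κT W)

/-- **Every class of `Hⱼ₊₁(W_U)`, `j ≥ 1`, is a sum of a class from the bottom copy of `M₁` and a
class from the bottom copy of `M₂`** (Mayer–Vietoris for the two punctured cylinders, whose
overlap is acyclic, and the bottom slices `Mᵢ ≃ punctured cylinder`). [cite: HatcherAT2002, §2.2 p. 149] -/
theorem exists_eq_add_map_bottom {j : ℕ} (hj : j ≠ 0) (w : singularHomology ℤ ℤ P (j + 1)) :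
    ∃ (z₁ : singularHomology ℤ ℤ M₁ (j + 1)) (z₂ : singularHomology ℤ ℤ M₂ (j + 1)),
      w = singularHomology.map ℤ ℤ (sideS D κS κT W).bottom (j + 1) z₁ +
        singularHomology.map ℤ ℤ (sideT D κS κT W).bottom (j + 1) z₂ := by
  have hcov : range (sideS D κS κT W).ι ∪ range (sideT D κS κT W).ι = univ := by
    rw [range_sideS_ι, range_sideT_ι]; exact W.cover
  have h0 : IsZero (singularHomology ℤ ℤ ↥(range (sideS D κS κT W).ι ∩ range (sideT D κS κT W).ι) j) := by
    rw [range_sideS_ι, range_sideT_ι]; exact isZero_singularHomology_inter D κS κT W hj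
  obtain ⟨u, v, huv⟩ := exists_add_eq_of_isZero_inter _ _ (sideS D κS κT W).isOpen_range_ι
    (sideT D κS κT W).isOpen_range_ι hcov h0 w
  obtain ⟨z₁, hz₁⟩ := (sideS D κS κT W).exists_map_subsetIncl_eq_map_bottom (j + 1) u
  obtain ⟨z₂, hz₂⟩ := (sideT D κS κT W).exists_map_subsetIncl_eq_map_bottom (j + 1) v
  exact ⟨z₁, z₂, by rw [← huv, hz₁, hz₂]⟩

end Glued

end Setup

/-! ### The merging cobordism -/

section Cobordism

variable {n : ℕ} {M₁ M₂ : Type} [TopologicalSpace M₁] [T2Space M₁] [SecondCountableTopology M₁]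
  [ChartedSpace (𝔼 (n + 1)) M₁] [IsManifold (𝓡 (n + 1)) ∞ M₁] [CompactSpace M₁] [Nonempty M₁]
  [TopologicalSpace M₂] [T2Space M₂] [SecondCountableTopology M₂]
  [ChartedSpace (𝔼 (n + 1)) M₂] [IsManifold (𝓡 (n + 1)) ∞ M₂] [CompactSpace M₂] [Nonempty M₂]
  (D : ConnectedSumData (n + 1) M₁ M₂)
  (κS : (cS (n := n) M₁).boundaryData.Collar) (κT : (cS (n := n) M₂).boundaryData.Collar)
  {P : Type} [TopologicalSpace P] [T2Space P] [SecondCountableTopology P]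
  [ChartedSpace (EuclideanHalfSpace (n + 2)) P] [IsManifold (𝓡∂ (n + 2)) ∞ P] [CompactSpace P]
  (W : HalfGluing (κS.halfDisc (Dσ D).i₁) (κT.halfDisc (Dσ D).i₂) P)
  {N : Type} [TopologicalSpace N] [ChartedSpace (𝔼 (n + 1)) N] [IsManifold (𝓡 (n + 1)) ∞ N]
  (Φ : ((Dσ D).glueData (Nat.succ_ne_zero n)).Glued ≃ₘ⟮𝓡 (n + 1), 𝓡 (n + 1)⟯
    ((M₁ ⊕ M₂) ⊕ (D.glueData (Nat.succ_ne_zero n)).Glued))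
  (ΦN : (D.glueData (Nat.succ_ne_zero n)).Glued ≃ₘ⟮𝓡 (n + 1), 𝓡 (n + 1)⟯ N)

/-- The glued null-cobordism `W_U` re-presented as a null-cobordism of
`(M₁ ⊔ M₂) ⊔ (M₁ # M₂)` along the split presentation `Φ`. [cite: KervaireMilnorAnnals1963, §2 Lemma 2.2] -/
def nullCob : NullCobordism (n + 1) ((M₁ ⊕ M₂) ⊕ (D.glueData (Nat.succ_ne_zero n)).Glued) :=
  (setup D κS κT W).glued.comap Φ.symm

/-- **The merging cobordism `W₀ = (M₁ × I) ♮ (M₂ × I)` from `N ≅ M₁ # M₂` to `M₁ ⊔ M₂`**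
(Kervaire–Milnor 1963, Lemma 2.2; Kirby 1989, Ch. VIII): total space `W_U`, incoming end the
connected sum of the top copies read in `N` through `Φ_N`, outgoing end the two bottom copies.
[cite: KervaireMilnorAnnals1963, §2 Lemma 2.2] [cite: Kirby1989, Ch. VIII] -/
def cobordism : Cobordism (n + 1) N (M₁ ⊕ M₂) where
  W := (nullCob D κS κT W Φ).W
  inl := (nullCob D κS κT W Φ).incl ∘ Sum.inr ∘ ΦN.symm
  inr := (nullCob D κS κT W Φ).incl ∘ Sum.inl
  isSmoothEmbedding_inl :=
    (isSmoothEmbedding_comp_inr (nullCob D κS κT W Φ).isSmoothEmbedding_incl).comp_diffeomorph ΦN.symm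
  isSmoothEmbedding_inr := isSmoothEmbedding_comp_inl (nullCob D κS κT W Φ).isSmoothEmbedding_incl
  disjoint_range := by
    refine disjoint_left.2 ?_
    rintro _ ⟨x, rfl⟩ ⟨y, hy⟩
    exact Sum.inl_ne_inr ((nullCob D κS κT W Φ).injective_incl hy)
  range_inl_union_range_inr := by
    refine Eq.trans ?_ (nullCob D κS κT W Φ).range_incl
    ext w
    constructor
    · rintro (⟨x, rfl⟩ | ⟨y, rfl⟩)
      · exact ⟨_, rfl⟩
      · exact ⟨_, rfl⟩
    · rintro ⟨y | x, rfl⟩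
      · exact Or.inr ⟨y, rfl⟩
      · refine Or.inl ⟨ΦN x, ?_⟩
        show (nullCob D κS κT W Φ).incl (Sum.inr (ΦN.symm (ΦN x))) = _
        rw [Diffeomorph.symm_apply_apply]

/-- The total space of the merging cobordism is `W_U`. [folklore] -/
@[simp] theorem cobordism_W : (cobordism D κS κT W Φ ΦN).W = P := rfl

variable (hΦA : ∀ a, Φ (((Dσ D).glueData (Nat.succ_ne_zero n)).inl a) =
    D.fA (Nat.succ_ne_zero n) (A' := M₁) (B' := M₂) ((D.splitA (B' := M₂)).symm a))
  (hΦB : ∀ b, Φ (((Dσ D).glueData (Nat.succ_ne_zero n)).inr b) =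
    D.fB (Nat.succ_ne_zero n) (A' := M₁) (B' := M₂) ((D.splitB (A' := M₁)).symm b))

omit [SecondCountableTopology M₁] [CompactSpace M₁] [Nonempty M₁] [SecondCountableTopology M₂]
  [CompactSpace M₂] [Nonempty M₂] in
include hΦA in
/-- `Φ⁻¹ ∘ fA = σ.inl ∘ splitA`. [folklore] -/
theorem symm_fA (q : M₁ ⊕ D.A) : Φ.symm (D.fA (Nat.succ_ne_zero n) (A' := M₁) (B' := M₂) q) =
    ((Dσ D).glueData (Nat.succ_ne_zero n)).inl (D.splitA (B' := M₂) q) := by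
  have h := hΦA (D.splitA (B' := M₂) q)
  rw [Diffeomorph.symm_apply_apply] at h
  rw [← h, Diffeomorph.symm_apply_apply]

omit [SecondCountableTopology M₁] [CompactSpace M₁] [Nonempty M₁] [SecondCountableTopology M₂]
  [CompactSpace M₂] [Nonempty M₂] in
include hΦB in
/-- `Φ⁻¹ ∘ fB = σ.inr ∘ splitB`. [folklore] -/
theorem symm_fB (q : M₂ ⊕ D.B) : Φ.symm (D.fB (Nat.succ_ne_zero n) (A' := M₁) (B' := M₂) q) =
    ((Dσ D).glueData (Nat.succ_ne_zero n)).inr (D.splitB (A' := M₁) q) := by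
  have h := hΦB (D.splitB (A' := M₁) q)
  rw [Diffeomorph.symm_apply_apply] at h
  rw [← h, Diffeomorph.symm_apply_apply]

include hΦA in
/-- **The bottom copy of `M₁` in `W₀`**: `inr (inl x) = ι₁ (x, 0)`. [folklore] -/
theorem inr_inl_apply (x : M₁) (h) :
    (cobordism D κS κT W Φ ΦN).inr (Sum.inl x) = W.ι₁ ⟨(cS M₁).incl (Sum.inl x), h⟩ := by
  show (setup D κS κT W).glued.incl (Φ.symm (Sum.inl (Sum.inl x))) = _
  have h1 : (Sum.inl (Sum.inl x) : (M₁ ⊕ M₂) ⊕ (D.glueData (Nat.succ_ne_zero n)).Glued) =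
      D.fA (Nat.succ_ne_zero n) (A' := M₁) (B' := M₂) (Sum.inl x) := rfl
  rw [h1, symm_fA D Φ hΦA]
  exact (setup D κS κT W).glued_incl_jA (D.splitA (B' := M₂) (Sum.inl x))

include hΦB in
/-- **The bottom copy of `M₂` in `W₀`**: `inr (inr y) = ι₂ (y, 0)`. [folklore] -/
theorem inr_inr_apply (y : M₂) (h) :
    (cobordism D κS κT W Φ ΦN).inr (Sum.inr y) = W.ι₂ ⟨(cS M₂).incl (Sum.inl y), h⟩ := by
  show (setup D κS κT W).glued.incl (Φ.symm (Sum.inl (Sum.inr y))) = _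
  have h1 : (Sum.inl (Sum.inr y) : (M₁ ⊕ M₂) ⊕ (D.glueData (Nat.succ_ne_zero n)).Glued) =
      D.fB (Nat.succ_ne_zero n) (A' := M₁) (B' := M₂) (Sum.inl y) := rfl
  rw [h1, symm_fB D Φ hΦB]
  exact (setup D κS κT W).glued_incl_jB (D.splitB (A' := M₁) (Sum.inl y))

variable {jA : D.A → N} {jB : D.B → N}
  (hΦNA : ∀ a, ΦN ((D.glueData (Nat.succ_ne_zero n)).inl a) = jA a)
  (hΦNB : ∀ b, ΦN ((D.glueData (Nat.succ_ne_zero n)).inr b) = jB b)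

include hΦA hΦNA in
/-- **The top copy of `M₁ ∖ {i₁ 0}` in `W₀` through `N`**: `inl (jA a) = ι₁ (a, 1)`. [folklore] -/
theorem inl_jA_apply (a : D.A) (h) :
    (cobordism D κS κT W Φ ΦN).inl (jA a) = W.ι₁ ⟨(cS M₁).incl (Sum.inr (a : M₁)), h⟩ := by
  show (setup D κS κT W).glued.incl (Φ.symm (Sum.inr (ΦN.symm (jA a)))) = _
  have h1 : ΦN.symm (jA a) = (D.glueData (Nat.succ_ne_zero n)).inl a := by
    rw [← hΦNA, Diffeomorph.symm_apply_apply]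
  have h2 : (Sum.inr ((D.glueData (Nat.succ_ne_zero n)).inl a) :
      (M₁ ⊕ M₂) ⊕ (D.glueData (Nat.succ_ne_zero n)).Glued) =
      D.fA (Nat.succ_ne_zero n) (A' := M₁) (B' := M₂) (Sum.inr a) := rfl
  rw [h1, h2, symm_fA D Φ hΦA]
  exact (setup D κS κT W).glued_incl_jA (D.splitA (B' := M₂) (Sum.inr a))

include hΦB hΦNB in
/-- **The top copy of `M₂ ∖ {i₂ 0}` in `W₀` through `N`**: `inl (jB b) = ι₂ (b, 1)`. [folklore] -/
theorem inl_jB_apply (b : D.B) (h) :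
    (cobordism D κS κT W Φ ΦN).inl (jB b) = W.ι₂ ⟨(cS M₂).incl (Sum.inr (b : M₂)), h⟩ := by
  show (setup D κS κT W).glued.incl (Φ.symm (Sum.inr (ΦN.symm (jB b)))) = _
  have h1 : ΦN.symm (jB b) = (D.glueData (Nat.succ_ne_zero n)).inr b := by
    rw [← hΦNB, Diffeomorph.symm_apply_apply]
  have h2 : (Sum.inr ((D.glueData (Nat.succ_ne_zero n)).inr b) :
      (M₁ ⊕ M₂) ⊕ (D.glueData (Nat.succ_ne_zero n)).Glued) =
      D.fB (Nat.succ_ne_zero n) (A' := M₁) (B' := M₂) (Sum.inr b) := rfl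
  rw [h1, h2, symm_fB D Φ hΦB]
  exact (setup D κS κT W).glued_incl_jB (D.splitB (A' := M₁) (Sum.inr b))

/-! #### The ends of `W₀` read on the two sides -/

/-- The incoming end `N → W₀` as a continuous map. [folklore] -/
abbrev inlC : C(N, P) :=
  ⟨(cobordism D κS κT W Φ ΦN).inl, (cobordism D κS κT W Φ ΦN).continuous_inl⟩

/-- The bottom copy `M₁ → W₀` as a continuous map. [folklore] -/
abbrev b₁C : C(M₁, P) :=
  ⟨(cobordism D κS κT W Φ ΦN).inr ∘ Sum.inl, (cobordism D κS κT W Φ ΦN).continuous_inr.comp continuous_inl⟩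

/-- The bottom copy `M₂ → W₀` as a continuous map. [folklore] -/
abbrev b₂C : C(M₂, P) :=
  ⟨(cobordism D κS κT W Φ ΦN).inr ∘ Sum.inr, (cobordism D κS κT W Φ ΦN).continuous_inr.comp continuous_inr⟩

include hΦA in
/-- The bottom copy of `M₁` is the bottom of the first side. [folklore] -/
theorem sideS_bottom : (sideS D κS κT W).bottom = b₁C D κS κT W Φ ΦN := by
  ext x
  exact (inr_inl_apply D κS κT W Φ ΦN hΦA x _).symm

include hΦB in
/-- The bottom copy of `M₂` is the bottom of the second side. [folklore] -/
theorem sideT_bottom : (sideT D κS κT W).bottom = b₂C D κS κT W Φ ΦN := by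
  ext y
  exact (inr_inr_apply D κS κT W Φ ΦN hΦB y _).symm

include hΦA hΦNA in
/-- The top copy of `M₁ ∖ {i₁ 0}` through `N` is the top of the first side. [folklore] -/
theorem sideS_top (hjA : Continuous jA) :
    (sideS D κS κT W).top = (inlC D κS κT W Φ ΦN).comp
      (⟨fun a => jA a, hjA⟩ : C(↥({(sideS D κS κT W).x₀}ᶜ : Set M₁), N)) := by
  ext a
  exact (inl_jA_apply D κS κT W Φ ΦN hΦA hΦNA a _).symm

include hΦB hΦNB in
/-- The top copy of `M₂ ∖ {i₂ 0}` through `N` is the top of the second side. [folklore] -/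
theorem sideT_top (hjB : Continuous jB) :
    (sideT D κS κT W).top = (inlC D κS κT W Φ ΦN).comp
      (⟨fun b => jB b, hjB⟩ : C(↥({(sideT D κS κT W).x₀}ᶜ : Set M₂), N)) := by
  ext b
  exact (inl_jB_apply D κS κT W Φ ΦN hΦB hΦNB b _).symm

end Cobordism


/-! ### The merging cobordism with its second homology (`hmerge` of Wall's assembly) -/

section Homology

variable {n : ℕ} {M₁ M₂ N : Type} [TopologicalSpace M₁] [T2Space M₁] [SecondCountableTopology M₁]
  [ChartedSpace (𝔼 (n + 1)) M₁] [IsManifold (𝓡 (n + 1)) ∞ M₁] [CompactSpace M₁]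
  [TopologicalSpace M₂] [T2Space M₂] [SecondCountableTopology M₂]
  [ChartedSpace (𝔼 (n + 1)) M₂] [IsManifold (𝓡 (n + 1)) ∞ M₂] [CompactSpace M₂]
  [TopologicalSpace N] [T2Space N] [ChartedSpace (𝔼 (n + 1)) N]

/-- The gluing data of `N = M₁ # M₂` assembled from connected sum data `D` (the discs) and a
presentation of `N` as the open gluing of the punctured pieces by `jA`, `jB`.
[cite: KervaireMilnorAnnals1963, §2 (p. 505)] -/
def neck (D : ConnectedSumData (n + 1) M₁ M₂) (jA : D.A → N) (jB : D.B → N)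
    (hjA : IsEmbedding jA) (hjB : IsEmbedding jB) (hjAo : IsOpen (range jA))
    (hjBo : IsOpen (range jB)) (hcov : range jA ∪ range jB = univ)
    (hrel : ∀ a b, jA a = jB b ↔ connectedSumRel D.i₁ D.i₂ a b) : ConnectedSumNeck (n + 1) M₁ M₂ N where
  i₁ := D.i₁
  i₂ := D.i₂
  jA := jA
  jB := jB
  continuous_i₁ := D.continuous_i₁
  injective_i₁ := D.isSmoothEmbedding_i₁.isEmbedding.injective
  continuous_i₂ := D.continuous_i₂
  injective_i₂ := D.isSmoothEmbedding_i₂.isEmbedding.injective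
  isEmbedding_jA := hjA
  isEmbedding_jB := hjB
  isOpen_range_jA := hjAo
  isOpen_range_jB := hjBo
  union_range := hcov
  rel := hrel

variable [SimplyConnectedSpace M₁] [SimplyConnectedSpace M₂] [IsManifold (𝓡 (n + 1)) ∞ N]

/-- **The merging cobordism `W₀ = (M₁ × I) ♮ (M₂ × I) : M₁ # M₂ ∼ M₁ ⊔ M₂` with its second
homology** (Kervaire–Milnor 1963, Lemma 2.2; Kirby 1989, Ch. VIII; the input `hmerge` of
`isHCobordant_of_equivalent_intersectionForm_of_constructions`, Wall 1964 §2 p. 146), for closed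
simply connected `M₁`, `M₂` of dimension `n + 1 ∉ {2, 3}` and `N` presented as `M₁ # M₂` by connected
sum data `D` and gluing maps `jA`, `jB`: there is a cobordism `W₀` from `N` to `M₁ ⊔ M₂` with simply
connected total space, and linear maps `ι₁ : H₂(M₁) → H₂(N)`, `ι₂ : H₂(M₂) → H₂(N)` — the summand
inclusions of `H₂(N) ≅ H₂(M₁) ⊕ H₂(M₂)` read through the collapse maps `c_{M₁}`, `c_{M₂}`
(`c_{M₁*} ι₁ = id`, `c_{M₂*} ι₁ = 0`, …) — such that `H₂(N) → H₂(W₀)` is onto and takes `ι₁ z`,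
`ι₂ z` to the classes of the bottom copies `M₁, M₂ ↪ W₀`. PROOF: `W₀ = W_S ♮ W_T` glued from the
two cylinders punctured at a top point (`setup`, `cobordism`); simply connected by van Kampen
(`simplyConnectedSpace_P`); `H₂(W₀)` is generated by the two bottom copies (Mayer–Vietoris,
`exists_eq_add_map_bottom`); `ι₁ = jA_* ∘ (incl_*)⁻¹` with `H₂(M₁ ∖ pt) ≅ H₂(M₁)`
(`isIso_map_subsetIncl_compl_singleton`), `c_{M₁} ∘ jA = incl`, `c_{M₂} ∘ jA` factors through the
contractible disc `i₂ (B̄)`, and in `W₀` the top copy of a class of `M₁ ∖ pt` is homologous to its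
bottom copy (`CylinderSide.map_top`). [cite: KervaireMilnorAnnals1963, §2 Lemma 2.2] [cite: WallJLMS1964, §2 p. 146] -/
theorem exists_cobordism_sum (h2 : 2 ≠ n + 1) (h3 : 3 ≠ n + 1)
    (D : ConnectedSumData (n + 1) M₁ M₂) (jA : D.A → N) (jB : D.B → N)
    (hjA : Manifold.IsSmoothEmbedding (𝓡 (n + 1)) (𝓡 (n + 1)) ∞ jA) (hjAo : IsOpen (range jA))
    (hjB : Manifold.IsSmoothEmbedding (𝓡 (n + 1)) (𝓡 (n + 1)) ∞ jB) (hjBo : IsOpen (range jB))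
    (hcov : range jA ∪ range jB = univ)
    (hrel : ∀ a b, jA a = jB b ↔ connectedSumRel D.i₁ D.i₂ a b) :
    ∃ (W₀ : Cobordism (n + 1) N (M₁ ⊕ M₂)) (_ : SimplyConnectedSpace W₀.W)
      (i₁ : singularHomology ℤ ℤ M₁ 2 →ₗ[ℤ] singularHomology ℤ ℤ N 2)
      (i₂ : singularHomology ℤ ℤ M₂ 2 →ₗ[ℤ] singularHomology ℤ ℤ N 2),
      Epi (singularHomology.map ℤ ℤ (⟨W₀.inl, W₀.continuous_inl⟩ : C(N, W₀.W)) 2) ∧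
      (∀ z, singularHomology.map ℤ ℤ
        (neck D jA jB hjA.isEmbedding hjB.isEmbedding hjAo hjBo hcov hrel).collapseLeft 2 (i₁ z) = z) ∧
      (∀ z, singularHomology.map ℤ ℤ
        (neck D jA jB hjA.isEmbedding hjB.isEmbedding hjAo hjBo hcov hrel).collapseRight 2 (i₁ z) = 0) ∧
      (∀ z, singularHomology.map ℤ ℤ
        (neck D jA jB hjA.isEmbedding hjB.isEmbedding hjAo hjBo hcov hrel).collapseLeft 2 (i₂ z) = 0) ∧
      (∀ z, singularHomology.map ℤ ℤ
        (neck D jA jB hjA.isEmbedding hjB.isEmbedding hjAo hjBo hcov hrel).collapseRight 2 (i₂ z) = z) ∧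
      (∀ z, singularHomology.map ℤ ℤ (⟨W₀.inl, W₀.continuous_inl⟩ : C(N, W₀.W)) 2 (i₁ z) =
        singularHomology.map ℤ ℤ (⟨W₀.inr ∘ Sum.inl, W₀.continuous_inr.comp continuous_inl⟩ :
          C(M₁, W₀.W)) 2 z) ∧
      (∀ z, singularHomology.map ℤ ℤ (⟨W₀.inl, W₀.continuous_inl⟩ : C(N, W₀.W)) 2 (i₂ z) =
        singularHomology.map ℤ ℤ (⟨W₀.inr ∘ Sum.inr, W₀.continuous_inr.comp continuous_inr⟩ :
          C(M₂, W₀.W)) 2 z) := by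
  classical
  have hd : n + 1 ≠ 0 := Nat.succ_ne_zero n
  -- collars of the two cylinders and the boundary connected sum `W_U = W_S ♮ W_T`
  obtain ⟨κS⟩ := BoundaryData.nonempty_collar_of_compactSpace n (cS (n := n) M₁).W
    (cS (n := n) M₁).boundaryData
  obtain ⟨κT⟩ := BoundaryData.nonempty_collar_of_compactSpace n (cS (n := n) M₂).W
    (cS (n := n) M₂).boundaryData
  have hiS := (Dσ D).isSmoothEmbedding_i₁
  have hiT := (Dσ D).isSmoothEmbedding_i₂
  have hkS := κS.isSmoothEmbedding_halfDisc hiS (isOpen_range_of_isSmoothEmbedding_disc hiS)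
  have hkT := κT.isSmoothEmbedding_halfDisc hiT (isOpen_range_of_isSmoothEmbedding_disc hiT)
  obtain ⟨P, _, _, _, _, _, hglue⟩ :=
    (HalfDiscPair.mk (κS.halfDisc (Dσ D).i₁) (κT.halfDisc (Dσ D).i₂) hkS.1 hkS.2 hkT.1
      hkT.2).exists_isOpenGluing
  haveI : CompactSpace P := compactSpace_of_isOpenGluing_boundaryConnectedSumRel_holds (n + 2)
    (cS (n := n) M₁).W (cS (n := n) M₂).W P _ _ hkS.1 hkS.2 hkT.1 hkT.2 hglue
  obtain ⟨W⟩ := HalfGluing.nonempty_of_isOpenGluing hglue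
  -- the split presentation `(M₁ ⊔ M₁) # (M₂ ⊔ M₂) ≅ (M₁ ⊔ M₂) ⊔ (M₁ # M₂)`
  have hA' := (D.isSmoothEmbedding_fA hd (A' := M₁) (B' := M₂)).comp_diffeomorph
    (D.splitA (B' := M₂)).symm
  have hB' := (D.isSmoothEmbedding_fB hd (A' := M₁) (B' := M₂)).comp_diffeomorph
    (D.splitB (A' := M₁)).symm
  have hrA : range (D.fA hd (A' := M₁) (B' := M₂) ∘ (D.splitA (B' := M₂)).symm) = range (D.fA hd) :=
    (D.splitA (B' := M₂)).symm.surjective.range_comp _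
  have hrB : range (D.fB hd (A' := M₁) (B' := M₂) ∘ (D.splitB (A' := M₁)).symm) = range (D.fB hd) :=
    (D.splitB (A' := M₁)).symm.surjective.range_comp _
  obtain ⟨Φ, hΦA, hΦB⟩ := IsOpenGluing.exists_diffeomorph_comp_eq (IP := 𝓡 (n + 1))
    (IP' := 𝓡 (n + 1)) (P := (Dσ D).Glued hd) (P' := (M₁ ⊕ M₂) ⊕ D.Glued hd)
    ((Dσ D).glueData hd).isSmoothEmbedding_inl ((Dσ D).glueData hd).isOpen_range_inl
    ((Dσ D).glueData hd).isSmoothEmbedding_inr ((Dσ D).glueData hd).isOpen_range_inr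
    ((Dσ D).glueData hd).range_inl_union_range_inr
    (fun a b => (Dσ D).inl_eq_inr_iff_connectedSumRel hd a b)
    hA' (hrA ▸ D.isOpen_range_fA hd) hB' (hrB ▸ D.isOpen_range_fB hd)
    (by rw [hrA, hrB]; exact D.range_fA_union_range_fB hd)
    (fun a b => D.fA_splitA_symm_eq_iff hd a b)
  -- the presentation of `N`
  obtain ⟨ΦN, hΦNA, hΦNB⟩ := IsOpenGluing.exists_diffeomorph_comp_eq (IP := 𝓡 (n + 1))
    (IP' := 𝓡 (n + 1)) (P := D.Glued hd) (P' := N)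
    (D.glueData hd).isSmoothEmbedding_inl (D.glueData hd).isOpen_range_inl
    (D.glueData hd).isSmoothEmbedding_inr (D.glueData hd).isOpen_range_inr
    (D.glueData hd).range_inl_union_range_inr (fun a b => D.inl_eq_inr_iff_connectedSumRel hd a b)
    hjA hjAo hjB hjBo hcov hrel
  -- notation
  set dN := neck D jA jB hjA.isEmbedding hjB.isEmbedding hjAo hjBo hcov hrel with hdN
  have hSb := sideS_bottom D κS κT W Φ ΦN hΦA
  have hTb := sideT_bottom D κS κT W Φ ΦN hΦB
  have hSt := sideS_top D κS κT W Φ ΦN hΦA hΦNA hjA.isEmbedding.continuous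
  have hTt := sideT_top D κS κT W Φ ΦN hΦB hΦNB hjB.isEmbedding.continuous
  -- `H₂(Mᵢ ∖ pt) ≅ H₂(Mᵢ)`
  haveI hv₁ : IsIso (singularHomology.map ℤ ℤ (HomologicalOrientation.valC (puncture dN.i₁)) 2) :=
    isIso_map_subsetIncl_compl_singleton (m := n + 1) (D.i₁ 0) (k := 2) h2 h3
  haveI hv₂ : IsIso (singularHomology.map ℤ ℤ (HomologicalOrientation.valC (puncture dN.i₂)) 2) :=
    isIso_map_subsetIncl_compl_singleton (m := n + 1) (D.i₂ 0) (k := 2) h2 h3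
  set v₁ := singularHomology.map ℤ ℤ (HomologicalOrientation.valC (puncture dN.i₁)) 2 with hv₁def
  set v₂ := singularHomology.map ℤ ℤ (HomologicalOrientation.valC (puncture dN.i₂)) 2 with hv₂def
  -- the summand inclusions `ιᵢ = (jᵢ)_* ∘ (incl_*)⁻¹`
  set ι₁ : singularHomology ℤ ℤ M₁ 2 ⟶ singularHomology ℤ ℤ N 2 :=
    inv v₁ ≫ singularHomology.map ℤ ℤ dN.jAC 2 with hι₁
  set ι₂ : singularHomology ℤ ℤ M₂ 2 ⟶ singularHomology ℤ ℤ N 2 :=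
    inv v₂ ≫ singularHomology.map ℤ ℤ dN.jBC 2 with hι₂
  have apply_eq : ∀ {A B C : ModuleCat ℤ} {f : A ⟶ B} {g : B ⟶ C} {h : A ⟶ C}, f ≫ g = h →
      ∀ x, g (f x) = h x := by
    intro A B C f g h hfg x
    rw [← ModuleCat.comp_apply, hfg]
  -- `jA_*` then `inl_*` is `incl_*` then the bottom copy (top copy ~ bottom copy in `W₀`)
  have F1 : singularHomology.map ℤ ℤ dN.jAC 2 ≫ singularHomology.map ℤ ℤ (inlC D κS κT W Φ ΦN) 2 =
      v₁ ≫ singularHomology.map ℤ ℤ (b₁C D κS κT W Φ ΦN) 2 := by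
    have h0 := (sideS D κS κT W).map_top 2
    rw [hSt, hSb, singularHomology.map_comp] at h0
    exact h0
  have F2 : singularHomology.map ℤ ℤ dN.jBC 2 ≫ singularHomology.map ℤ ℤ (inlC D κS κT W Φ ΦN) 2 =
      v₂ ≫ singularHomology.map ℤ ℤ (b₂C D κS κT W Φ ΦN) 2 := by
    have h0 := (sideT D κS κT W).map_top 2
    rw [hTt, hTb, singularHomology.map_comp] at h0
    exact h0
  have E3 : ι₁ ≫ singularHomology.map ℤ ℤ (inlC D κS κT W Φ ΦN) 2 =
      singularHomology.map ℤ ℤ (b₁C D κS κT W Φ ΦN) 2 := by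
    rw [hι₁, Category.assoc, F1, IsIso.inv_hom_id_assoc]
  have E3' : ι₂ ≫ singularHomology.map ℤ ℤ (inlC D κS κT W Φ ΦN) 2 =
      singularHomology.map ℤ ℤ (b₂C D κS κT W Φ ΦN) 2 := by
    rw [hι₂, Category.assoc, F2, IsIso.inv_hom_id_assoc]
  -- `c_{M₁} ∘ jA = incl`, `c_{M₂} ∘ jB = incl`
  have E1 : ι₁ ≫ singularHomology.map ℤ ℤ dN.collapseLeft 2 = 𝟙 _ := by
    rw [hι₁, Category.assoc, ← singularHomology.map_comp, dN.collapseLeft_comp_jAC]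
    exact IsIso.inv_hom_id v₁
  have E1' : ι₂ ≫ singularHomology.map ℤ ℤ dN.collapseRight 2 = 𝟙 _ := by
    rw [hι₂, Category.assoc, ← singularHomology.map_comp, dN.collapseRight_comp_jBC]
    exact IsIso.inv_hom_id v₂
  -- `c_{M₂} ∘ jA`, `c_{M₁} ∘ jB` factor through the contractible discs `i₂ (B̄)`, `i₁ (B̄)`
  have E2 : ι₁ ≫ singularHomology.map ℤ ℤ dN.collapseRight 2 = 0 := by
    rw [hι₁, Category.assoc, ← singularHomology.map_comp]
    haveI : ContractibleSpace ↥(dN.i₂ '' closedBall (0 : 𝔼 (n + 1)) 1) :=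
      dN.swap.contractibleSpace_image_closedBall
    let r : C(↥(puncture dN.i₁), ↥(dN.i₂ '' closedBall (0 : 𝔼 (n + 1)) 1)) :=
      ⟨fun a => ⟨dN.collapseRight (dN.jA a), dN.swap.collapseLeft_jB_mem a⟩,
        (dN.collapseRight.continuous.comp dN.isEmbedding_jA.continuous).subtype_mk _⟩
    have hfac : dN.collapseRight.comp dN.jAC = (subsetIncl _).comp r := by ext a; rfl
    have h0 : singularHomology.map ℤ ℤ r 2 = 0 :=
      (isZero_singularHomology_of_contractibleSpace ℤ ℤ
        (X := ↥(dN.i₂ '' closedBall (0 : 𝔼 (n + 1)) 1)) two_ne_zero).eq_of_tgt _ _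
    rw [hfac, singularHomology.map_comp, h0, zero_comp, comp_zero]
  have E2' : ι₂ ≫ singularHomology.map ℤ ℤ dN.collapseLeft 2 = 0 := by
    rw [hι₂, Category.assoc, ← singularHomology.map_comp]
    haveI : ContractibleSpace ↥(dN.i₁ '' closedBall (0 : 𝔼 (n + 1)) 1) :=
      dN.contractibleSpace_image_closedBall
    let r : C(↥(puncture dN.i₂), ↥(dN.i₁ '' closedBall (0 : 𝔼 (n + 1)) 1)) :=
      ⟨fun b => ⟨dN.collapseLeft (dN.jB b), dN.collapseLeft_jB_mem b⟩,
        (dN.collapseLeft.continuous.comp dN.isEmbedding_jB.continuous).subtype_mk _⟩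
    have hfac : dN.collapseLeft.comp dN.jBC = (subsetIncl _).comp r := by ext b; rfl
    have h0 : singularHomology.map ℤ ℤ r 2 = 0 :=
      (isZero_singularHomology_of_contractibleSpace ℤ ℤ
        (X := ↥(dN.i₁ '' closedBall (0 : 𝔼 (n + 1)) 1)) two_ne_zero).eq_of_tgt _ _
    rw [hfac, singularHomology.map_comp, h0, zero_comp, comp_zero]
  -- `H₂(N) → H₂(W₀)` is onto: `H₂(W₀)` is generated by the two bottom copies
  have hepi : Epi (singularHomology.map ℤ ℤ (inlC D κS κT W Φ ΦN) 2) := by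
    rw [ModuleCat.epi_iff_surjective]
    intro w
    obtain ⟨z₁, z₂, hw⟩ := exists_eq_add_map_bottom D κS κT W (j := 1) one_ne_zero w
    refine ⟨ι₁ z₁ + ι₂ z₂, ?_⟩
    rw [map_add, hw, hSb, hTb]
    exact congrArg₂ (· + ·) (apply_eq E3 z₁) (apply_eq E3' z₂)
  have hsc : SimplyConnectedSpace P := simplyConnectedSpace_P D κS κT W
  refine ⟨cobordism D κS κT W Φ ΦN, hsc, ι₁.hom, ι₂.hom, hepi,
    fun z => ?_, fun z => ?_, fun z => ?_, fun z => ?_, fun z => ?_, fun z => ?_⟩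
  · exact (apply_eq E1 z).trans rfl
  · exact (apply_eq E2 z).trans rfl
  · exact (apply_eq E2' z).trans rfl
  · exact (apply_eq E1' z).trans rfl
  · exact apply_eq E3 z
  · exact apply_eq E3' z

end Homology

/-! ### Wall's `hmerge` in dimension four -/

section Four

/-- **The input `hmerge` of `isHCobordant_of_equivalent_intersectionForm_of_constructions`,
discharged**: for closed smooth simply connected 4-manifolds `M₁`, `M₂` and any `N` presented as
`M₁ # M₂` by gluing data `d` with smooth discs and gluing maps, the merging cobordism
`W₀ = (M₁ × I) ♮ (M₂ × I)` from `N` to `M₁ ⊔ M₂` with its second homology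
(`exists_cobordism_sum` at `n + 1 = 4`, the discs of `d` re-read as inverses of charts of the
maximal atlas, `ConnectedSumData.exists_of_isSmoothEmbedding`).
[cite: KervaireMilnorAnnals1963, §2 Lemma 2.2] [cite: WallJLMS1964, §2 p. 146] -/
theorem hmerge_holds : ∀ (M₁ M₂ N : Type) [TopologicalSpace M₁] [T2Space M₁] [SecondCountableTopology M₁]
      [ChartedSpace (𝔼 4) M₁] [IsManifold (𝓡 4) ∞ M₁] [CompactSpace M₁] [SimplyConnectedSpace M₁]
      [TopologicalSpace M₂] [T2Space M₂] [SecondCountableTopology M₂]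
      [ChartedSpace (𝔼 4) M₂] [IsManifold (𝓡 4) ∞ M₂] [CompactSpace M₂] [SimplyConnectedSpace M₂]
      [TopologicalSpace N] [T2Space N] [SecondCountableTopology N]
      [ChartedSpace (𝔼 4) N] [IsManifold (𝓡 4) ∞ N] [CompactSpace N] [SimplyConnectedSpace N]
      (d : ConnectedSumNeck 4 M₁ M₂ N),
      Manifold.IsSmoothEmbedding (𝓡 4) (𝓡 4) ∞ d.i₁ → Manifold.IsSmoothEmbedding (𝓡 4) (𝓡 4) ∞ d.i₂ →
      Manifold.IsSmoothEmbedding (𝓡 4) (𝓡 4) ∞ d.jA → Manifold.IsSmoothEmbedding (𝓡 4) (𝓡 4) ∞ d.jB →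
      ∃ (W₀ : Cobordism 4 N (M₁ ⊕ M₂)) (_ : SimplyConnectedSpace W₀.W)
        (i₁ : singularHomology ℤ ℤ M₁ 2 →ₗ[ℤ] singularHomology ℤ ℤ N 2)
        (i₂ : singularHomology ℤ ℤ M₂ 2 →ₗ[ℤ] singularHomology ℤ ℤ N 2),
        Epi (singularHomology.map ℤ ℤ (⟨W₀.inl, W₀.continuous_inl⟩ : C(N, W₀.W)) 2) ∧
        (∀ z, singularHomology.map ℤ ℤ d.collapseLeft 2 (i₁ z) = z) ∧
        (∀ z, singularHomology.map ℤ ℤ d.collapseRight 2 (i₁ z) = 0) ∧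
        (∀ z, singularHomology.map ℤ ℤ d.collapseLeft 2 (i₂ z) = 0) ∧
        (∀ z, singularHomology.map ℤ ℤ d.collapseRight 2 (i₂ z) = z) ∧
        (∀ z, singularHomology.map ℤ ℤ (⟨W₀.inl, W₀.continuous_inl⟩ : C(N, W₀.W)) 2 (i₁ z) =
          singularHomology.map ℤ ℤ (⟨W₀.inr ∘ Sum.inl, W₀.continuous_inr.comp continuous_inl⟩ :
            C(M₁, W₀.W)) 2 z) ∧
        (∀ z, singularHomology.map ℤ ℤ (⟨W₀.inl, W₀.continuous_inl⟩ : C(N, W₀.W)) 2 (i₂ z) =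
          singularHomology.map ℤ ℤ (⟨W₀.inr ∘ Sum.inr, W₀.continuous_inr.comp continuous_inr⟩ :
            C(M₂, W₀.W)) 2 z) := by
  intro M₁ M₂ N _ _ _ _ _ _ _ _ _ _ _ _ _ _ _ _ _ _ _ _ _ d hi₁ hi₂ hjA hjB
  obtain ⟨i₁, i₂, jA, jB, hci₁, hinj₁, hci₂, hinj₂, hjAe, hjBe, hAo, hBo, hU, hrel⟩ := d
  obtain ⟨e₁, he₁, ht₁, rfl⟩ := ConnectedSumData.exists_of_isSmoothEmbedding hi₁
  obtain ⟨e₂, he₂, ht₂, rfl⟩ := ConnectedSumData.exists_of_isSmoothEmbedding hi₂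
  exact exists_cobordism_sum (n := 3) (by norm_num) (by norm_num) ⟨e₁, e₂, he₁, he₂, ht₁, ht₂⟩
    jA jB hjA hAo hjB hBo hU hrel

end Four

end MergingCobordism

end Literature.Topology.FourManifolds

end
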